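import Summits.HodgeConjecture.HodgeConjecture.Theorems.MarkmanPartnerTransportPicardThreeK3SquaresSectorTransport
import Summits.HodgeConjecture.HodgeConjecture.Theorems.MarkmanPartnerTransportPicardThreeK3SquaresSectorIff
import Summits.HodgeConjecture.HodgeConjecture.Theorems.NikulinTwinTransportTwinSimilitudeAlgebraicMarkings
import Summits.HodgeConjecture.HodgeConjecture.Theorems.NikulinTwinTransportSquareTranscendental
import Literature.AlgebraicGeometry.Surfaces.K3SurfaceProofs
import Literature.AlgebraicGeometry.Surfaces.K3HodgeTypesHolds

/-!
# Route MarkmanPartnerTransport · crux `PicardThreeK3Squares` (stmt-HodgeConjecture-19652) —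
# ISOGENY INVARIANCE of the Hodge conjecture for K3 squares, and the reduction of the crux to rational
# Hodge-isometry classes (modulo Buskin's theorem)

`…SectorTransport` (route-independent) proves that Varesco's cycle-induced-sector clause transports
along a rational Hodge isometry `φ : H²(S'(ℂ); ℂ) ⥲ H²(S(ℂ); ℂ)` of projective K3 surfaces satisfying the
hypotheses of `Buskin2019_hodgeIsometry_algebraic` both ways. With Varesco's equivalence
(`SectorIff.hodgeConjectureFor_square_iff_cycleInducedSector`: HC⁴(S ⊗ S) ⟺ the clause) this file states
the ISOGENY INVARIANCE of HC⁴ for K3 squares, first at the level of `H²` and then in the LATTICE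
rendering of the crux: markings `η : H²(S(ℂ); ℂ) ≅ Λ_ℂ`, `η'` of the two surfaces (integral classes
`↔ Λ = ℤ²²`, cup product `=` K3 form times an integral generator of `H⁴`, `(2,0)`-classes `η⁻¹ x`,
`η'⁻¹ x'` with `(x̄.x) > 0`), and an isometry `σ` of `(Λ_ℂ, k3Form)` DEFINED OVER `ℚ` carrying the period
of `S'` into the period line of `S` — "`S` and `S'` are isogenous" (Huybrechts 2019: `T(S)_ℚ ≃ T(S')_ℚ`
Hodge-isometrically, Witt-extended to `H²`). ALL of Buskin's hypotheses for `φ = η⁻¹ σ η'` and for its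
inverse `ψ = η'⁻¹ σ⁻¹ η` are then theorems of the tree: rationality
(`NikulinTwinTransport.isRationalClass_markingConj`), cup forms (`cupProduct_markingConj`), every Hodge
type (`isOfHodgeType_markingConj`, with `Huybrechts_K3_hodgeTypes_H2_holds`: the K3 Hodge structure is
determined by its `(2,0)`-line), and `σ⁻¹` is again a rational isometry (`exists_inverse_ratIsometry`:
non-degeneracy of the K3 form and finite-dimensionality of `Λ_ℚ`).

* `hodgeConjectureFor_square_of_hodgeIsometry`, `hodgeConjectureFor_square_iff_of_hodgeIsometry` —
  **HC⁴(S' ⊗ S') ↔ HC⁴(S ⊗ S) along a rational Hodge isometry `H²(S') ⥲ H²(S)`, mod Buskin.**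
* `injective_of_k3Form_isometry`, `exists_inverse_ratIsometry` — a rational isometry of `(Λ_ℂ, k3Form)`
  is invertible with rational isometric inverse (non-degeneracy: `NikulinTwinTransport.k3FormC_nondegenerate`).
* `hodgeConjectureFor_square_of_markedIsometry`, `hodgeConjectureFor_square_iff_of_markedIsometry` —
  **isogenous marked projective K3 surfaces have equivalent HC⁴ for their squares (mod Buskin).**
* `picardThreeK3Squares_of_isogenousRepresentatives` — **the crux reduces to isometry classes**: to
  prove `PicardThreeK3Squares` it suffices, for each marked projective K3 surface `(S, η, p, x)` with
  `ρ(S) ≥ 3`, to exhibit ONE isogenous marked projective K3 surface `S'` (rational isometry `σ` of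
  `Λ_ℂ` with `σ x' ∈ ℂ x`) with HC⁴(S' ⊗ S') — the seat's strategy clause «reduce Picard-rank-3 squares
  to isometry classes» as a theorem; `hodgeConjectureFor_square_of_picardThreeK3Squares_of_isogenous` —
  conversely the crux propagates to every K3 surface isogenous to one of Picard rank `≥ 3`.

Consequence for the landed sectors (no new statement needed): each of them — CM (`CMThird`), `E = ℚ`,
the cycle-induced RM families (`SquareOfGenerator`), the `σ_p`-locus (`SymplecticLocus`, Varesco 2023
Thm. 2.1 stated for `S` itself carrying the automorphism) and the Kuga–Satake sector at `ρ = 16`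
(`KugaSatakeSector`) — extends verbatim to every projective K3 surface ISOGENOUS to a member, which for
the `σ_p`-locus is exactly the printed generality of Varesco 2023 Thm. 1 ("`X` Hodge isometric to a K3
surface with a symplectic automorphism of order `p`").

No definition, no sorry; the only named-fact hypothesis is `Buskin2019_hodgeIsometry_algebraic`.
Prover seat hodge-nonav-19652-p1 (gen 3), `--supports stmt-HodgeConjecture-19652`.

References: Buskin, J. reine angew. Math. 755 (2019), Thm. 1.1, §6.2; Huybrechts, Comment. Math. Helv.
94 (2019), Thm. 0.2, §1.1; Varesco, Math. Z. 305 (2023) art. 69 = arXiv:2304.02519, §0.2, Thm. 1 and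
§2 (p. 8); Huybrechts, *Lectures on K3 Surfaces*, Ch. 6 Prop. 1.2, Rem. 3.3, Ch. 14 §0.3.
-/

set_option linter.dupNamespace false

noncomputable section

namespace Summit.HodgeConjecture.HodgeConjecture.Theorems.MarkmanPartnerTransport.IsogenyInvariance

open CategoryTheory MonoidalCategory
open Literature.AlgebraicGeometry Literature.AlgebraicGeometry.Motives Literature.AlgebraicGeometry.HodgeTheory
open Literature.AlgebraicGeometry.Surfaces
open Literature.AlgebraicTopology.SingularHomology
open Summit.HodgeConjecture.HodgeConjecture.Theorems.NikulinTwinTransport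
open Summit.HodgeConjecture.HodgeConjecture.Theorems.MarkmanPartnerTransport.SectorTransport

variable {S S' : SchemeOver ℂ}

/-! ### Isogeny invariance along a rational Hodge isometry of `H²` (mod Buskin) -/

/-- **The Hodge conjecture for K3 squares is invariant under rational Hodge isometries of `H²`
(mod Buskin's Thm. 1.1).** Let `S, S'` be projective K3 surfaces, `p, p'` integral generators of
`H⁴(S(ℂ))`, `H⁴(S'(ℂ))`, and `φ : H²(S'(ℂ); ℂ) → H²(S(ℂ); ℂ)`, `ψ : H²(S(ℂ); ℂ) → H²(S'(ℂ); ℂ)`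
mutually inverse `ℂ`-linear maps, each rational, Hodge-type preserving and isometric
(`x ∪ y = a p' ⟹ φ x ∪ φ y = a p`, resp. with `p, p'` exchanged). If `Buskin2019_hodgeIsometry_algebraic`
holds, then `HodgeConjectureFor 4 (S' ⊗ S') → HodgeConjectureFor 4 (S ⊗ S)`: Varesco's equivalence on
`S'` (`SectorIff.cycleInducedSector_of_hodgeConjectureFor_square`) and the transport of the clause
(`SectorTransport.hodgeConjectureFor_square_of_hodgeIsometry_of_sector`). [cite: Buskin2019, Thm. 1.1]
[cite: Varesco2023, §0.2 and §2 (p. 8)] -/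
theorem hodgeConjectureFor_square_of_hodgeIsometry (hB : Buskin2019_hodgeIsometry_algebraic)
    (μ : OrientationFamily) (hS : IsK3Surface S) (hS' : IsK3Surface S')
    (p : complexBetti S (2 * 2)) (p' : complexBetti S' (2 * 2))
    (hp : IsIntegralClass p ∧ ∀ q : complexBetti S (2 * 2), IsIntegralClass q → ∃ n : ℤ, q = n • p)
    (hp' : IsIntegralClass p' ∧ ∀ q : complexBetti S' (2 * 2), IsIntegralClass q → ∃ n : ℤ, q = n • p')
    (φ : complexBetti S' (2 * 1) →ₗ[ℂ] complexBetti S (2 * 1))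
    (ψ : complexBetti S (2 * 1) →ₗ[ℂ] complexBetti S' (2 * 1))
    (hφψ : ∀ x, φ (ψ x) = x) (hψφ : ∀ y, ψ (φ y) = y)
    (hφrat : ∀ y, IsRationalClass y → IsRationalClass (φ y))
    (hψrat : ∀ x, IsRationalClass x → IsRationalClass (ψ x))
    (hφtyp : ∀ (i j : ℕ) y, IsOfHodgeType 2 S' (2 * 1) i j y → IsOfHodgeType 2 S (2 * 1) i j (φ y))
    (hψtyp : ∀ (i j : ℕ) x, IsOfHodgeType 2 S (2 * 1) i j x → IsOfHodgeType 2 S' (2 * 1) i j (ψ x))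
    (hφiso : ∀ (x y : complexBetti S' (2 * 1)) (a : ℂ),
      cupProduct (rfl : 2 * 1 + 2 * 1 = 2 * 2) x y = a • p' →
        cupProduct (rfl : 2 * 1 + 2 * 1 = 2 * 2) (φ x) (φ y) = a • p)
    (hψiso : ∀ (x y : complexBetti S (2 * 1)) (a : ℂ),
      cupProduct (rfl : 2 * 1 + 2 * 1 = 2 * 2) x y = a • p →
        cupProduct (rfl : 2 * 1 + 2 * 1 = 2 * 2) (ψ x) (ψ y) = a • p')
    (hHC' : HodgeConjectureFor 4 (S' ⊗ S')) :
    HodgeConjectureFor 4 (S ⊗ S) :=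
  hodgeConjectureFor_square_of_hodgeIsometry_of_sector hB μ hS hS' p p' hp hp' φ ψ hφψ hψφ hφrat hψrat
    hφtyp hψtyp hφiso hψiso
    (SectorIff.cycleInducedSector_of_hodgeConjectureFor_square μ hS'.isSmoothProjective hHC')

/-- **Iff form**: along a rational Hodge isometry `H²(S') ≅ H²(S)` (data as in
`hodgeConjectureFor_square_of_hodgeIsometry`), `HodgeConjectureFor 4 (S ⊗ S) ↔ HodgeConjectureFor 4 (S' ⊗ S')`
(mod Buskin). [cite: Buskin2019, Thm. 1.1] [cite: Varesco2023, §0.2] -/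
theorem hodgeConjectureFor_square_iff_of_hodgeIsometry (hB : Buskin2019_hodgeIsometry_algebraic)
    (μ : OrientationFamily) (hS : IsK3Surface S) (hS' : IsK3Surface S')
    (p : complexBetti S (2 * 2)) (p' : complexBetti S' (2 * 2))
    (hp : IsIntegralClass p ∧ ∀ q : complexBetti S (2 * 2), IsIntegralClass q → ∃ n : ℤ, q = n • p)
    (hp' : IsIntegralClass p' ∧ ∀ q : complexBetti S' (2 * 2), IsIntegralClass q → ∃ n : ℤ, q = n • p')
    (φ : complexBetti S' (2 * 1) →ₗ[ℂ] complexBetti S (2 * 1))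
    (ψ : complexBetti S (2 * 1) →ₗ[ℂ] complexBetti S' (2 * 1))
    (hφψ : ∀ x, φ (ψ x) = x) (hψφ : ∀ y, ψ (φ y) = y)
    (hφrat : ∀ y, IsRationalClass y → IsRationalClass (φ y))
    (hψrat : ∀ x, IsRationalClass x → IsRationalClass (ψ x))
    (hφtyp : ∀ (i j : ℕ) y, IsOfHodgeType 2 S' (2 * 1) i j y → IsOfHodgeType 2 S (2 * 1) i j (φ y))
    (hψtyp : ∀ (i j : ℕ) x, IsOfHodgeType 2 S (2 * 1) i j x → IsOfHodgeType 2 S' (2 * 1) i j (ψ x))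
    (hφiso : ∀ (x y : complexBetti S' (2 * 1)) (a : ℂ),
      cupProduct (rfl : 2 * 1 + 2 * 1 = 2 * 2) x y = a • p' →
        cupProduct (rfl : 2 * 1 + 2 * 1 = 2 * 2) (φ x) (φ y) = a • p)
    (hψiso : ∀ (x y : complexBetti S (2 * 1)) (a : ℂ),
      cupProduct (rfl : 2 * 1 + 2 * 1 = 2 * 2) x y = a • p →
        cupProduct (rfl : 2 * 1 + 2 * 1 = 2 * 2) (ψ x) (ψ y) = a • p') :
    HodgeConjectureFor 4 (S ⊗ S) ↔ HodgeConjectureFor 4 (S' ⊗ S') :=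
  ⟨hodgeConjectureFor_square_of_hodgeIsometry hB μ hS' hS p' p hp' hp ψ φ hψφ hφψ hψrat hφrat hψtyp
      hφtyp hψiso hφiso,
    hodgeConjectureFor_square_of_hodgeIsometry hB μ hS hS' p p' hp hp' φ ψ hφψ hψφ hφrat hψrat hφtyp
      hψtyp hφiso hψiso⟩


/-! ### Rational isometries of `Λ_ℂ` are invertible, with rational inverse -/

/-- An isometry of `(Λ_ℂ, k3Form)` is injective (the form is non-degenerate,
`NikulinTwinTransport.k3FormC_nondegenerate`). [folklore] -/
theorem injective_of_k3Form_isometry (σ : Module.End ℂ (K3Index → ℂ))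
    (hσ : ∀ a b, k3Form (σ a) (σ b) = k3Form a b) : Function.Injective σ := by
  rw [← LinearMap.ker_eq_bot, LinearMap.ker_eq_bot']
  intro a ha
  refine k3FormC_nondegenerate.1 a fun b ↦ ?_
  rw [k3FormC_apply, ← hσ, ha, k3Form_zero_left]

/-- **A rational isometry of `(Λ_ℂ, k3Form)` has a rational isometric inverse.** If `σ` preserves the
K3 form and maps `Λ` into `Λ_ℚ`, then `σ` is bijective (injective by non-degeneracy, `Λ_ℂ`
finite-dimensional) and `σ⁻¹` again preserves the form and maps `Λ` into `Λ_ℚ` (the `ℚ`-form `τ` of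
`σ`, `exists_ratEnd_of_forall_intCast`, is an injective hence surjective endomorphism of `Λ_ℚ = ℚ²²`).
[cite: Buskin2019, §6.2 (the induced isometry `ϕ : Λ_ℚ → Λ_ℚ`)] -/
theorem exists_inverse_ratIsometry (σ : Module.End ℂ (K3Index → ℂ))
    (hσ : ∀ a b, k3Form (σ a) (σ b) = k3Form a b)
    (hrat : ∀ v : K3Index → ℤ, ∃ w : K3Index → ℚ, σ (fun i => (v i : ℂ)) = fun i => (w i : ℂ)) :
    ∃ σ' : Module.End ℂ (K3Index → ℂ), (∀ a, σ (σ' a) = a) ∧ (∀ a, σ' (σ a) = a) ∧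
      (∀ a b, k3Form (σ' a) (σ' b) = k3Form a b) ∧
      (∀ v : K3Index → ℤ, ∃ w : K3Index → ℚ, σ' (fun i => (v i : ℂ)) = fun i => (w i : ℂ)) := by
  classical
  have hinj := injective_of_k3Form_isometry σ hσ
  have hbij : Function.Bijective σ := ⟨hinj, LinearMap.surjective_of_injective hinj⟩
  let e : (K3Index → ℂ) ≃ₗ[ℂ] (K3Index → ℂ) := LinearEquiv.ofBijective σ hbij
  have he : ∀ a, e a = σ a := fun a ↦ rfl
  refine ⟨e.symm.toLinearMap, fun a ↦ ?_, fun a ↦ ?_, fun a b ↦ ?_, fun v ↦ ?_⟩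
  · change σ (e.symm a) = a
    rw [← he, LinearEquiv.apply_symm_apply]
  · change e.symm (σ a) = a
    rw [← he, LinearEquiv.symm_apply_apply]
  · change k3Form (e.symm a) (e.symm b) = k3Form a b
    conv_rhs => rw [← e.apply_symm_apply a, ← e.apply_symm_apply b, he, he, hσ]
  · -- rationality of the inverse: the `ℚ`-form `τ` of `σ` is surjective on `Λ_ℚ`
    obtain ⟨τ, hτ⟩ := exists_ratEnd_of_forall_intCast σ hrat
    have hτinj : Function.Injective τ := by
      intro u u' h
      have h1 : σ (fun i => (u i : ℂ)) = σ (fun i => (u' i : ℂ)) := by rw [hτ, hτ, h]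
      have h2 := hinj h1
      funext i
      exact_mod_cast congrFun h2 i
    obtain ⟨u, hu⟩ := LinearMap.surjective_of_injective hτinj (fun i => (v i : ℚ))
    refine ⟨u, ?_⟩
    change e.symm _ = _
    rw [LinearEquiv.symm_apply_eq, he, hτ, hu]
    funext i
    simp only [Rat.cast_intCast]

/-! ### Isogeny invariance in the MARKED (lattice) form of the crux -/

/-- **HC⁴ along a marked rational Hodge isometry, mod Buskin.** Let `S, S'` be projective K3 surfaces
with markings `η : H²(S(ℂ); ℂ) ≅ Λ_ℂ`, `η'` (integral classes `↔ Λ = ℤ²²`; cup product `=` K3 form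
times integral generators `p, p'` of `H⁴`; `(2,0)`-classes `η⁻¹ x`, `η'⁻¹ x'` with `(x̄.x) > 0`,
`(x̄'.x') > 0`), and let `σ` be an isometry of `(Λ_ℂ, k3Form)` DEFINED OVER `ℚ` (`σ Λ ⊆ Λ_ℚ`) carrying
the period of `S'` into the period line of `S` (`σ x' ∈ ℂ x`) — i.e. `η⁻¹ ∘ σ ∘ η'` is a rational Hodge
isometry `H²(S', ℚ) ⥲ H²(S, ℚ)` ("`S` and `S'` are isogenous"). If `Buskin2019_hodgeIsometry_algebraic`
holds, then `HodgeConjectureFor 4 (S' ⊗ S') → HodgeConjectureFor 4 (S ⊗ S)`. All of Buskin's hypotheses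
for `φ = η⁻¹ σ η'` and `ψ = η'⁻¹ σ⁻¹ η` are derived: rationality (`isRationalClass_markingConj`), the cup
forms (`cupProduct_markingConj`), every Hodge type (`isOfHodgeType_markingConj` with the tree's theorem
`Huybrechts_K3_hodgeTypes_H2_holds`), and `σ⁻¹` rational isometric (`exists_inverse_ratIsometry`).
[cite: Buskin2019, Thm. 1.1 and §6.2] [cite: Huybrechts2016K3, Ch. 6 Prop. 1.2 and Rem. 3.3]
[cite: Varesco2023, §0.2] -/
theorem hodgeConjectureFor_square_of_markedIsometry (hB : Buskin2019_hodgeIsometry_algebraic)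
    (hS : IsK3Surface S) (hS' : IsK3Surface S')
    (η : complexBetti S (2 * 1) ≃ₗ[ℂ] (K3Index → ℂ)) (p : complexBetti S (2 * 2)) (x : K3Index → ℂ)
    (η' : complexBetti S' (2 * 1) ≃ₗ[ℂ] (K3Index → ℂ)) (p' : complexBetti S' (2 * 2))
    (x' : K3Index → ℂ)
    (hp : IsIntegralClass p ∧ ∀ q : complexBetti S (2 * 2), IsIntegralClass q → ∃ n : ℤ, q = n • p)
    (hηint : ∀ c : complexBetti S (2 * 1),
      IsIntegralClass c ↔ ∃ v : K3Index → ℤ, η c = fun i => (v i : ℂ))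
    (hηcup : ∀ a b : complexBetti S (2 * 1),
      cupProduct (rfl : 2 * 1 + 2 * 1 = 2 * 2) a b = k3Form (η a) (η b) • p)
    (h20 : IsOfHodgeType 2 S (2 * 1) 2 0 (η.symm x)) (hx : 0 < (k3Form (star x) x).re)
    (hp' : IsIntegralClass p' ∧ ∀ q : complexBetti S' (2 * 2), IsIntegralClass q → ∃ n : ℤ, q = n • p')
    (hη'int : ∀ c : complexBetti S' (2 * 1),
      IsIntegralClass c ↔ ∃ v : K3Index → ℤ, η' c = fun i => (v i : ℂ))
    (hη'cup : ∀ a b : complexBetti S' (2 * 1),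
      cupProduct (rfl : 2 * 1 + 2 * 1 = 2 * 2) a b = k3Form (η' a) (η' b) • p')
    (h20' : IsOfHodgeType 2 S' (2 * 1) 2 0 (η'.symm x')) (hx' : 0 < (k3Form (star x') x').re)
    (σ : Module.End ℂ (K3Index → ℂ)) (hσ : ∀ a b, k3Form (σ a) (σ b) = k3Form a b)
    (hσrat : ∀ v : K3Index → ℤ, ∃ w : K3Index → ℚ, σ (fun i => (v i : ℂ)) = fun i => (w i : ℂ))
    (hper : ∃ t : ℂ, σ x' = t • x)
    (hHC' : HodgeConjectureFor 4 (S' ⊗ S')) : HodgeConjectureFor 4 (S ⊗ S) := by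
  have hHT : Huybrechts_K3_hodgeTypes_H2 := Huybrechts_K3_hodgeTypes_H2_holds
  have hp0 : p ≠ 0 := generator_ne_zero hS hp.2
  have hp'0 : p' ≠ 0 := generator_ne_zero hS' hp'.2
  obtain ⟨σ', hσσ', hσ'σ, hσ', hσ'rat⟩ := exists_inverse_ratIsometry σ hσ hσrat
  -- the period condition for `σ⁻¹`
  obtain ⟨t, ht⟩ := hper
  have ht0 : t ≠ 0 := by
    rintro rfl
    rw [zero_smul] at ht
    have hx'0 : x' = 0 := by rw [← hσ'σ x', ht, map_zero]
    exact ne_zero_of_star_self_re_pos hx' hx'0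
  have hper' : ∃ t' : ℂ, σ' x = t' • x' :=
    ⟨t⁻¹, by rw [← hσ'σ x', ht, map_smul, smul_smul, inv_mul_cancel₀ ht0, one_smul]⟩
  have hσ1 : ∀ a b, k3Form (σ a) (σ b) = 1 * k3Form a b := fun a b ↦ by rw [hσ, one_mul]
  have hσ'1 : ∀ a b, k3Form (σ' a) (σ' b) = 1 * k3Form a b := fun a b ↦ by rw [hσ', one_mul]
  -- the two maps `φ = η⁻¹ σ η'`, `ψ = η'⁻¹ σ⁻¹ η`
  refine hodgeConjectureFor_square_of_hodgeIsometry hB complexOrientationFamily hS hS' p p' hp hp'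
    (η.symm.toLinearMap ∘ₗ σ ∘ₗ η'.toLinearMap) (η'.symm.toLinearMap ∘ₗ σ' ∘ₗ η.toLinearMap)
    (fun y ↦ ?_) (fun y ↦ ?_) (fun y hy ↦ ?_) (fun y hy ↦ ?_) (fun i j y hy ↦ ?_) (fun i j y hy ↦ ?_)
    (fun a b c h ↦ ?_) (fun a b c h ↦ ?_) hHC'
  · simp only [LinearMap.comp_apply, LinearEquiv.coe_coe, LinearEquiv.apply_symm_apply, hσσ',
      LinearEquiv.symm_apply_apply]
  · simp only [LinearMap.comp_apply, LinearEquiv.coe_coe, LinearEquiv.apply_symm_apply, hσ'σ,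
      LinearEquiv.symm_apply_apply]
  · simp only [LinearMap.comp_apply, LinearEquiv.coe_coe]
    exact isRationalClass_markingConj η η' σ hS hS' hηint hη'int hσrat hy
  · simp only [LinearMap.comp_apply, LinearEquiv.coe_coe]
    exact isRationalClass_markingConj η' η σ' hS' hS hη'int hηint hσ'rat hy
  · simp only [LinearMap.comp_apply, LinearEquiv.coe_coe]
    exact isOfHodgeType_markingConj η p x η' p' x' σ hHT hS hS' hηint hηcup h20 hx hη'int hη'cup hp'0
      h20' hx' hσrat one_ne_zero hσ1 ⟨t, ht⟩ i j y hy
  · simp only [LinearMap.comp_apply, LinearEquiv.coe_coe]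
    exact isOfHodgeType_markingConj η' p' x' η p x σ' hHT hS' hS hη'int hη'cup h20' hx' hηint hηcup hp0
      h20 hx hσ'rat one_ne_zero hσ'1 hper' i j y hy
  · simp only [LinearMap.comp_apply, LinearEquiv.coe_coe]
    have h1 := cupProduct_markingConj η p η' p' σ hp'0 hηcup hη'cup hσ1 a b c h
    rwa [one_mul] at h1
  · simp only [LinearMap.comp_apply, LinearEquiv.coe_coe]
    have h1 := cupProduct_markingConj η' p' η p σ' hp0 hη'cup hηcup hσ'1 a b c h
    rwa [one_mul] at h1

/-- **Iff form in the marked rendering**: isogenous marked projective K3 surfaces `S, S'` (a rational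
isometry `σ` of `Λ_ℂ` carrying the period of `S'` into the period line of `S`) satisfy
`HodgeConjectureFor 4 (S ⊗ S) ↔ HodgeConjectureFor 4 (S' ⊗ S')`, mod Buskin. The reverse direction
runs along `σ⁻¹` (`exists_inverse_ratIsometry`), which carries `x` into `ℂ x'`.
[cite: Buskin2019, Thm. 1.1] [cite: Varesco2023, §0.2] -/
theorem hodgeConjectureFor_square_iff_of_markedIsometry (hB : Buskin2019_hodgeIsometry_algebraic)
    (hS : IsK3Surface S) (hS' : IsK3Surface S')
    (η : complexBetti S (2 * 1) ≃ₗ[ℂ] (K3Index → ℂ)) (p : complexBetti S (2 * 2)) (x : K3Index → ℂ)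
    (η' : complexBetti S' (2 * 1) ≃ₗ[ℂ] (K3Index → ℂ)) (p' : complexBetti S' (2 * 2))
    (x' : K3Index → ℂ)
    (hp : IsIntegralClass p ∧ ∀ q : complexBetti S (2 * 2), IsIntegralClass q → ∃ n : ℤ, q = n • p)
    (hηint : ∀ c : complexBetti S (2 * 1),
      IsIntegralClass c ↔ ∃ v : K3Index → ℤ, η c = fun i => (v i : ℂ))
    (hηcup : ∀ a b : complexBetti S (2 * 1),
      cupProduct (rfl : 2 * 1 + 2 * 1 = 2 * 2) a b = k3Form (η a) (η b) • p)
    (h20 : IsOfHodgeType 2 S (2 * 1) 2 0 (η.symm x)) (hx : 0 < (k3Form (star x) x).re)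
    (hp' : IsIntegralClass p' ∧ ∀ q : complexBetti S' (2 * 2), IsIntegralClass q → ∃ n : ℤ, q = n • p')
    (hη'int : ∀ c : complexBetti S' (2 * 1),
      IsIntegralClass c ↔ ∃ v : K3Index → ℤ, η' c = fun i => (v i : ℂ))
    (hη'cup : ∀ a b : complexBetti S' (2 * 1),
      cupProduct (rfl : 2 * 1 + 2 * 1 = 2 * 2) a b = k3Form (η' a) (η' b) • p')
    (h20' : IsOfHodgeType 2 S' (2 * 1) 2 0 (η'.symm x')) (hx' : 0 < (k3Form (star x') x').re)
    (σ : Module.End ℂ (K3Index → ℂ)) (hσ : ∀ a b, k3Form (σ a) (σ b) = k3Form a b)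
    (hσrat : ∀ v : K3Index → ℤ, ∃ w : K3Index → ℚ, σ (fun i => (v i : ℂ)) = fun i => (w i : ℂ))
    (hper : ∃ t : ℂ, σ x' = t • x) :
    HodgeConjectureFor 4 (S ⊗ S) ↔ HodgeConjectureFor 4 (S' ⊗ S') := by
  refine ⟨fun hHC ↦ ?_, hodgeConjectureFor_square_of_markedIsometry hB hS hS' η p x η' p' x' hp hηint
    hηcup h20 hx hp' hη'int hη'cup h20' hx' σ hσ hσrat hper⟩
  obtain ⟨σ', -, hσ'σ, hσ', hσ'rat⟩ := exists_inverse_ratIsometry σ hσ hσrat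
  obtain ⟨t, ht⟩ := hper
  have ht0 : t ≠ 0 := by
    rintro rfl
    rw [zero_smul] at ht
    have hx'0 : x' = 0 := by rw [← hσ'σ x', ht, map_zero]
    exact ne_zero_of_star_self_re_pos hx' hx'0
  exact hodgeConjectureFor_square_of_markedIsometry hB hS' hS η' p' x' η p x hp' hη'int hη'cup h20' hx'
    hp hηint hηcup h20 hx σ' hσ' hσ'rat
    ⟨t⁻¹, by rw [← hσ'σ x', ht, map_smul, smul_smul, inv_mul_cancel₀ ht0, one_smul]⟩ hHC

/-! ### The crux reduces to rational Hodge-isometry classes -/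

/-- `MarkedK3[S, η, p, x]`: VERBATIM the `let MarkedK3 := …` binder of the route declaration
`PicardThreeK3Squares` (a marking `η` of the projective K3 surface `S` with integral generator `p ≠ 0`
of `H⁴`, period `x` spanning `H^{2,0}`, and `x` a projective period point). Local notation only. -/
local notation3 (prettyPrint := false) "MarkedK3[" S ", " η ", " p ", " x "]" =>
  (p ≠ 0 ∧ (IsIntegralClass p ∧
    (∀ q : complexBetti S (2 * 2), IsIntegralClass q → ∃ n : ℤ, q = n • p) ∧
    (∀ c : complexBetti S (2 * 1), IsIntegralClass c ↔ ∃ v : K3Index → ℤ, η c = fun i => (v i : ℂ)) ∧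
    (∀ a b : complexBetti S (2 * 1),
      cupProduct (rfl : 2 * 1 + 2 * 1 = 2 * 2) a b = k3Form (η a) (η b) • p) ∧
    IsOfHodgeType 2 S (2 * 1) 2 0 (LinearEquiv.symm η x) ∧
    (∀ τ : complexBetti S (2 * 1), IsOfHodgeType 2 S (2 * 1) 2 0 τ →
      ∃ t : ℂ, τ = t • LinearEquiv.symm η x)) ∧
    (k3Form x x = 0 ∧ 0 < (k3Form (star x) x).re ∧
      ∃ u : K3Index → ℤ, k3Form (fun i => (u i : ℂ)) x = 0 ∧ 0 < ∑ i, ∑ j, u i * k3Gram i j * u j))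

/-- **`PicardThreeK3Squares` reduces to isometry classes (mod Buskin's Thm. 1.1).** To prove the crux
it suffices, for every marked projective K3 surface `(S, η, p, x)` with `ρ(S) ≥ 3`, to exhibit ONE
marked projective K3 surface `(S', η', p', x')` together with a rational isometry `σ` of
`(Λ_ℂ, k3Form)` carrying `x'` into `ℂ x` (i.e. `S'` isogenous to `S`: `T(S')_ℚ ≃ T(S)_ℚ` as rational
Hodge structures with their forms, Witt-extended to `H²`) for which `HodgeConjectureFor 4 (S' ⊗ S')`
is known. This is the seat's strategy clause «reduce Picard-rank-3 squares to isometry classes» as a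
theorem: the Hodge conjecture for K3 squares is a function on the set of rational Hodge-isometry
classes of `(H²(S, ℚ), ∪, H^{2,0})`. [cite: Buskin2019, Thm. 1.1] [cite: Varesco2023, §0.2]
[cite: Huybrechts2019, Thm. 0.2] -/
theorem picardThreeK3Squares_of_isogenousRepresentatives (hB : Buskin2019_hodgeIsometry_algebraic)
    (h : ∀ (S : SchemeOver ℂ), IsK3Surface S →
      ∀ (η : complexBetti S (2 * 1) ≃ₗ[ℂ] (K3Index → ℂ)) (p : complexBetti S (2 * 2))
        (x : K3Index → ℂ), MarkedK3[S, η, p, x] → 3 ≤ Module.finrank ℂ ↥(algebraicClasses S 1) →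
      ∃ (S' : SchemeOver ℂ) (_ : IsK3Surface S') (η' : complexBetti S' (2 * 1) ≃ₗ[ℂ] (K3Index → ℂ))
        (p' : complexBetti S' (2 * 2)) (x' : K3Index → ℂ) (σ : Module.End ℂ (K3Index → ℂ)),
        MarkedK3[S', η', p', x'] ∧ (∀ a b, k3Form (σ a) (σ b) = k3Form a b) ∧
        (∀ v : K3Index → ℤ, ∃ w : K3Index → ℚ, σ (fun i => (v i : ℂ)) = fun i => (w i : ℂ)) ∧
        (∃ t : ℂ, σ x' = t • x) ∧ HodgeConjectureFor 4 (S' ⊗ S')) :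
    Summit.HodgeConjecture.HodgeConjecture.Theses.MarkmanPartnerTransport.PicardThreeK3Squares := by
  intro S hS η p x hM hρ
  obtain ⟨S', hS', η', p', x', σ, hM', hσ, hσrat, hper, hHC'⟩ := h S hS η p x hM hρ
  obtain ⟨-, ⟨hpint, hpgen, hηint, hηcup, h20, -⟩, -, hx, -⟩ := hM
  obtain ⟨-, ⟨hp'int, hp'gen, hη'int, hη'cup, h20', -⟩, -, hx', -⟩ := hM'
  exact hodgeConjectureFor_square_of_markedIsometry hB hS hS' η p x η' p' x' ⟨hpint, hpgen⟩ hηint hηcup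
    h20 hx ⟨hp'int, hp'gen⟩ hη'int hη'cup h20' hx' σ hσ hσrat hper hHC'

/-- **Conversely, the crux propagates along isogenies to ALL Picard ranks of the class**: if
`PicardThreeK3Squares` holds, then HC⁴(S' ⊗ S') holds for every marked projective K3 surface `S'`
isogenous (marked rational Hodge isometry) to a marked projective K3 surface `S` with `ρ(S) ≥ 3` — no
hypothesis on `ρ(S')` is needed in the statement (it equals `ρ(S)`, but that is not used).
[cite: Buskin2019, Thm. 1.1] [cite: Varesco2023, §0.2] -/
theorem hodgeConjectureFor_square_of_picardThreeK3Squares_of_isogenous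
    (hB : Buskin2019_hodgeIsometry_algebraic)
    (h4 : Summit.HodgeConjecture.HodgeConjecture.Theses.MarkmanPartnerTransport.PicardThreeK3Squares)
    (hS : IsK3Surface S) (hS' : IsK3Surface S')
    (η : complexBetti S (2 * 1) ≃ₗ[ℂ] (K3Index → ℂ)) (p : complexBetti S (2 * 2)) (x : K3Index → ℂ)
    (η' : complexBetti S' (2 * 1) ≃ₗ[ℂ] (K3Index → ℂ)) (p' : complexBetti S' (2 * 2))
    (x' : K3Index → ℂ) (hM : MarkedK3[S, η, p, x]) (hM' : MarkedK3[S', η', p', x'])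
    (hρ : 3 ≤ Module.finrank ℂ ↥(algebraicClasses S 1))
    (σ : Module.End ℂ (K3Index → ℂ)) (hσ : ∀ a b, k3Form (σ a) (σ b) = k3Form a b)
    (hσrat : ∀ v : K3Index → ℤ, ∃ w : K3Index → ℚ, σ (fun i => (v i : ℂ)) = fun i => (w i : ℂ))
    (hper : ∃ t : ℂ, σ x = t • x') :
    HodgeConjectureFor 4 (S' ⊗ S') := by
  have hHC : HodgeConjectureFor 4 (S ⊗ S) := h4 S hS η p x hM hρ
  obtain ⟨-, ⟨hpint, hpgen, hηint, hηcup, h20, -⟩, -, hx, -⟩ := hM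
  obtain ⟨-, ⟨hp'int, hp'gen, hη'int, hη'cup, h20', -⟩, -, hx', -⟩ := hM'
  exact hodgeConjectureFor_square_of_markedIsometry hB hS' hS η' p' x' η p x ⟨hp'int, hp'gen⟩ hη'int
    hη'cup h20' hx' ⟨hpint, hpgen⟩ hηint hηcup h20 hx σ hσ hσrat hper hHC

end Summit.HodgeConjecture.HodgeConjecture.Theorems.MarkmanPartnerTransport.IsogenyInvariance

end
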